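import Literature.Probability.RandomPlanarGeometry.SAWTubeRenewal
import HarnessLib

/-!
# `β_m⟨T⟩ β_n⟨T⟩ ≤ β_{m+n}⟨T⟩` and `β_n⟨T⟩ ≤ μ⟨R[k,T]⟩^n` for the tube-renewal class `𝓑_N⟨T⟩`
# (Madras–Slade §8.2, proof of Theorem 8.2.1)

Topic `Literature/Probability/RandomPlanarGeometry` (continues `SAWTubeRenewal.lean`: `𝓑_N⟨T⟩ =
tubeBridges`, `β_N⟨T⟩ = tubeBeta`, the gluing `concatWalk_mem_tubeBridges`). Source: N. Madras,
G. Slade, *The Self-Avoiding Walk* (1993), §8.2, proof of Theorem 8.2.1, pp. 282–283. The printed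
proof uses, when it "cop[ies] the argument leading from (4.2.2) to (4.2.4)", that the renewal
sequence `β_N⟨T⟩ z⟨T⟩^N` is bounded (by `1`): on `ℤ^d` this is `b_N ≤ μ^N` ((1.2.17), by
supermultiplicativity of `b_N`); in `R[k,T]` the class `𝓑⟨T⟩` is closed under concatenation (the
second bridge starts on the floor), so `β_m β_n ≤ β_{m+n}`, whence `β_n^j ≤ β_{jn} ≤ c_{jn}(R)` and
`β_n ≤ (c_{jn}(R)^{1/(jn)})^n → μ(R)^n` by (8.2.3).

## Contents (namespace `Literature.Probability.RandomPlanarGeometry.SAW.Zd`, all PROVED)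

`tubeBeta_mul_le` (`β_m β_n ≤ β_{m+n}`), `tubeBeta_pow_le` (`β_n^j ≤ β_{jn}`),
**`tubeBeta_le_pow`** (`β_n⟨T⟩ ≤ μ⟨R[k,T]⟩^n`).
-/

noncomputable section

open Finset Filter Topology Literature.Probability.LatticeModels Literature.Probability.Percolation
open scoped BigOperators

namespace Literature.Probability.RandomPlanarGeometry.SAW.Zd

variable {d : ℕ} [NeZero d] {k : ℕ}

/-! ### Supermultiplicativity and `β_n⟨T⟩ ≤ μ⟨R[k,T]⟩^n` -/

/-- **`β_m⟨T⟩ β_n⟨T⟩ ≤ β_{m+n}⟨T⟩`**: concatenation maps `𝓑_m⟨T⟩ × 𝓑_n⟨T⟩` injectively into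
`𝓑_{m+n}⟨T⟩`. [cite: MadrasSlade1993, §8.2, proof of Theorem 8.2.1] -/
theorem tubeBeta_mul_le (k T m n : ℕ) :
    tubeBeta d k T m * tubeBeta d k T n ≤ tubeBeta d k T (m + n) := by
  classical
  rw [tubeBeta, tubeBeta, tubeBeta, ← Finset.card_product]
  refine Finset.card_le_card_of_injOn (fun p => concatWalk m p.1 p.2) ?_ ?_
  · rintro ⟨η, τ⟩ hp
    rw [Finset.mem_coe, Finset.mem_product] at hp
    have hτ : τ ∈ tubeBridges d k T (m + n - m) := by rw [Nat.add_sub_cancel_left]; exact hp.2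
    exact concatWalk_mem_tubeBridges (Nat.le_add_right m n) hp.1 hτ
  · rintro ⟨η, τ⟩ hp ⟨η', τ'⟩ hp' h
    rw [Finset.mem_coe, Finset.mem_product] at hp hp'
    have h1 := fun (ξ : ℕ → Site d) (j : ℕ) (hξ : ξ ∈ tubeBridges d k T j) =>
      (mem_bridges.1 (mem_tubeBridges.1 hξ).1).1
    obtain ⟨h2, h3⟩ := concatWalk_injective_pieces (h1 η m hp.1) (h1 τ n hp.2) (h1 η' m hp'.1)
      (h1 τ' n hp'.2) h
    rw [h2, h3]

/-- `β_n⟨T⟩^j ≤ β_{jn}⟨T⟩`. [cite: MadrasSlade1993, §8.2, proof of Theorem 8.2.1] -/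
theorem tubeBeta_pow_le (k T n j : ℕ) : tubeBeta d k T n ^ j ≤ tubeBeta d k T (j * n) := by
  induction j with
  | zero => rw [pow_zero, zero_mul, tubeBeta_zero]
  | succ j ih =>
    rw [pow_succ, Nat.succ_mul]
    exact (Nat.mul_le_mul_right _ ih).trans (tubeBeta_mul_le k T (j * n) n)

/-- **`β_n⟨T⟩ ≤ μ⟨R[k,T]⟩^n`**: `β_n^j ≤ β_{jn} ≤ c_{jn}(R)`, so `β_n ≤ (c_{jn}(R)^{1/(jn)})^n → μ(R)^n`
as `j → ∞` ((8.2.3)). [cite: MadrasSlade1993, §8.2, proof of Theorem 8.2.1, with eq. (8.2.3)] -/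
theorem tubeBeta_le_pow (hk : 1 ≤ k) (T n : ℕ) :
    (tubeBeta d k T n : ℝ) ≤ tubeConnectiveConstant d k T ^ n := by
  rcases Nat.eq_zero_or_pos n with rfl | hn
  · rw [tubeBeta_zero, pow_zero, Nat.cast_one]
  -- `F j = (c_{jn}(R)^{1/(jn)})^n → μ(R)^n`
  have hlim : Tendsto (fun j : ℕ => ((tubeCount d k T (j * n) : ℝ) ^ (1 / ((j * n : ℕ) : ℝ))) ^ n)
      atTop (𝓝 (tubeConnectiveConstant d k T ^ n)) := by
    have h1 : Tendsto (fun j : ℕ => j * n) atTop atTop :=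
      tendsto_atTop_mono (fun j => Nat.le_mul_of_pos_right j hn) tendsto_id
    exact ((tendsto_tubeCount_rpow hk T).comp h1).pow n
  refine ge_of_tendsto hlim ?_
  filter_upwards [eventually_ge_atTop 1] with j hj
  have hβ0 : (0 : ℝ) ≤ tubeBeta d k T n := Nat.cast_nonneg _
  have hc0 : (0 : ℝ) ≤ tubeCount d k T (j * n) := Nat.cast_nonneg _
  have hjn : ((j * n : ℕ) : ℝ) ≠ 0 := by positivity
  have hj0 : (j : ℝ) ≠ 0 := by positivity
  -- `β_n = (β_n^j)^{1/j} ≤ c_{jn}(R)^{1/j} = (c_{jn}(R)^{1/(jn)})^n`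
  have h1 : ((tubeBeta d k T n : ℝ) ^ j) ≤ tubeCount d k T (j * n) := by
    exact_mod_cast (tubeBeta_pow_le (d := d) k T n j).trans (tubeBeta_le_tubeCount k T (j * n))
  have h2 : (tubeBeta d k T n : ℝ) = ((tubeBeta d k T n : ℝ) ^ j) ^ (1 / (j : ℝ)) := by
    rw [one_div, Real.pow_rpow_inv_natCast hβ0 (by omega)]
  have h3 : ((tubeCount d k T (j * n) : ℝ) ^ (1 / ((j * n : ℕ) : ℝ))) ^ n =
      (tubeCount d k T (j * n) : ℝ) ^ (1 / (j : ℝ)) := by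
    rw [← Real.rpow_natCast, ← Real.rpow_mul hc0]
    congr 1
    push_cast
    field_simp
  rw [h2, h3]
  exact Real.rpow_le_rpow (pow_nonneg hβ0 j) h1 (by positivity)

end Literature.Probability.RandomPlanarGeometry.SAW.Zd

end
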